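import Literature.NumberTheory.GaloisRepresentations.LocalClassFieldAxiom
import HarnessLib

/-!
# The norm index of a cyclic extension of a local field, for abstract field extensions

`Literature.NumberTheory.GaloisRepresentations.LocalWeilDatum.cyclicNormIndexEq_holds`
(`LocalClassFieldAxiom.lean`, Neukirch Ch. V Thm. (1.1), the `H⁰` part of the class field axiom)
states `(Kˣ : N_{L/K} Lˣ) = [L : K]` for the finite subextensions `K ⊆ L` of `F̄` over a
non-archimedean local field `F` with `L/K` cyclic.  This file transports it to ABSTRACT towers
`F → K → L` (`K/F` finite, `L/K` finite Galois with cyclic group), the form consumed by the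
Brauer-group bounds (`natCard_resKer_layer_le`, `natCard_resKer_bot_le`):

* `Literature.NumberTheory.GaloisRepresentations.index_range_unitsMap_norm_eq_of_equiv_equiv` —
  the norm index is invariant under compatible isomorphisms `K ≃ K'`, `L ≃ L'`
  (`Algebra.norm_eq_of_equiv_equiv`);
* `Literature.NumberTheory.GaloisRepresentations.galHomOfEquivEquiv` — the injective homomorphism
  `Gal(L'/K') → Gal(L/K)` attached to compatible isomorphisms (so `Gal(L'/K')` is cyclic if
  `Gal(L/K)` is);
* `Literature.NumberTheory.GaloisRepresentations.normIndex_eq_finrank_of_isNonarchimedeanLocalField`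
  — for `F` a non-archimedean local field of characteristic `0`, `K/F` finite and `L/K` finite
  cyclic Galois: `(Kˣ : N_{L/K} Lˣ) = [L : K]` (embed `L` into `F̄` by `IsAlgClosed.lift` and apply
  `cyclicNormIndexEq_holds` to the images).

## References
* J. Neukirch, *Algebraic Number Theory*, Springer, 1999, Ch. V §1 Thm. (1.1). [NeukirchANT1999]
* J.-P. Serre, *Corps locaux*, Hermann, 1968, XIII §3–4, XIV §1. [SerreLocalFields1979]
-/

noncomputable section

open Function IntermediateField

universe u

namespace Literature.NumberTheory.GaloisRepresentations

open LocalWeilDatum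

/-! ### Invariance of the norm index and of cyclicity under isomorphisms -/

section Transport

variable {K L K' L' : Type*} [Field K] [Field L] [Field K'] [Field L'] [Algebra K L] [Algebra K' L']
variable (eK : K ≃+* K') (eL : L ≃+* L')
  (he : (algebraMap K' L').comp (eK : K →+* K') = (eL : L →+* L').comp (algebraMap K L))

include he in
/-- Pointwise form of the compatibility. [folklore] -/
theorem algebraMap_equiv_apply (y : K) : algebraMap K' L' (eK y) = eL (algebraMap K L y) :=
  RingHom.congr_fun he y

include he in
/-- `N_{L'/K'}(e_L y) = e_K (N_{L/K} y)`. [folklore] -/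
theorem norm_equiv_apply (y : L) :
    Algebra.norm K' (eL y) = eK (Algebra.norm K y) := by
  rw [Algebra.norm_eq_of_equiv_equiv eK eL he y, RingEquiv.apply_symm_apply]

include he in
/-- **The norm subgroups correspond**: `e_K (N_{L/K} Lˣ) = N_{L'/K'} L'ˣ`. [folklore] -/
theorem map_range_unitsMap_norm_eq :
    ((Units.map (Algebra.norm K (S := L) : L →* K)).range).map
        ((Units.mapEquiv eK.toMulEquiv : Kˣ ≃* K'ˣ) : Kˣ →* K'ˣ) =
      (Units.map (Algebra.norm K' (S := L') : L' →* K')).range := by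
  ext u'
  constructor
  · rintro ⟨u, ⟨y, rfl⟩, rfl⟩
    refine ⟨Units.map (eL : L →+* L').toMonoidHom y, Units.ext ?_⟩
    change Algebra.norm K' (eL (y : L)) = eK (Algebra.norm K (y : L))
    exact norm_equiv_apply eK eL he y
  · rintro ⟨y', rfl⟩
    refine ⟨Units.map (Algebra.norm K (S := L) : L →* K)
      (Units.map (eL.symm : L' →+* L).toMonoidHom y'), ⟨_, rfl⟩, Units.ext ?_⟩
    change eK (Algebra.norm K (eL.symm (y' : L'))) = Algebra.norm K' (y' : L')
    rw [← norm_equiv_apply eK eL he, RingEquiv.apply_symm_apply]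

include he in
/-- **The norm index is invariant under compatible isomorphisms.** [folklore] -/
theorem index_range_unitsMap_norm_eq_of_equiv_equiv :
    (Units.map (Algebra.norm K (S := L) : L →* K)).range.index =
      (Units.map (Algebra.norm K' (S := L') : L' →* K')).range.index := by
  rw [← map_range_unitsMap_norm_eq eK eL he, Subgroup.index_map_equiv]

/-- The ring automorphism of `L` attached to `σ' ∈ Gal(L'/K')`: `e_L⁻¹ ∘ σ' ∘ e_L`. [folklore] -/
def ringEquivOfGal (σ' : L' ≃ₐ[K'] L') : L ≃+* L :=
  eL.trans ((σ' : L' ≃+* L').trans eL.symm)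

/-- Unfolding `ringEquivOfGal`. [folklore] -/
@[simp] theorem ringEquivOfGal_apply (σ' : L' ≃ₐ[K'] L') (x : L) :
    ringEquivOfGal eL σ' x = eL.symm (σ' (eL x)) := rfl

include he in
/-- `e_L⁻¹ ∘ σ' ∘ e_L` is `K`-linear. [folklore] -/
theorem ringEquivOfGal_algebraMap (σ' : L' ≃ₐ[K'] L') (y : K) :
    ringEquivOfGal eL σ' (algebraMap K L y) = algebraMap K L y := by
  rw [ringEquivOfGal_apply, ← algebraMap_equiv_apply eK eL he, σ'.commutes,
    algebraMap_equiv_apply eK eL he, RingEquiv.symm_apply_apply]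

/-- **The homomorphism `Gal(L'/K') → Gal(L/K)`, `σ' ↦ e_L⁻¹ ∘ σ' ∘ e_L`.** [folklore] -/
def galHomOfEquivEquiv : (L' ≃ₐ[K'] L') →* (L ≃ₐ[K] L) where
  toFun σ' := AlgEquiv.ofRingEquiv (f := ringEquivOfGal eL σ')
    (ringEquivOfGal_algebraMap eK eL he σ')
  map_one' := by
    ext x
    change eL.symm ((1 : L' ≃ₐ[K'] L') (eL x)) = x
    rw [AlgEquiv.one_apply, RingEquiv.symm_apply_apply]
  map_mul' σ' τ' := by
    ext x
    change eL.symm ((σ' * τ') (eL x)) = eL.symm (σ' (eL (eL.symm (τ' (eL x)))))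
    rw [AlgEquiv.mul_apply, RingEquiv.apply_symm_apply]

/-- Unfolding `galHomOfEquivEquiv`. [folklore] -/
@[simp] theorem galHomOfEquivEquiv_apply (σ' : L' ≃ₐ[K'] L') (x : L) :
    galHomOfEquivEquiv eK eL he σ' x = eL.symm (σ' (eL x)) := rfl

/-- `galHomOfEquivEquiv` is injective. [folklore] -/
theorem galHomOfEquivEquiv_injective : Injective (galHomOfEquivEquiv eK eL he) := by
  intro σ' τ' h
  ext x'
  obtain ⟨x, rfl⟩ := eL.surjective x'
  have hx := AlgEquiv.congr_fun h x
  rw [galHomOfEquivEquiv_apply, galHomOfEquivEquiv_apply] at hx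
  exact eL.symm.injective hx

include he in
/-- **`Gal(L'/K')` is cyclic if `Gal(L/K)` is.** [folklore] -/
theorem isCyclic_gal_of_equiv_equiv [IsCyclic (L ≃ₐ[K] L)] : IsCyclic (L' ≃ₐ[K'] L') :=
  isCyclic_of_injective _ (galHomOfEquivEquiv_injective eK eL he)

end Transport

/-! ### The norm index for abstract cyclic extensions of a local field -/

section Local

open ValuativeRel

variable (F : Type u) [Field F] [ValuativeRel F] [TopologicalSpace F] [IsNonarchimedeanLocalField F]

/-- **`(Kˣ : N_{L/K} Lˣ) = [L : K]` for `K` finite over a non-archimedean local field `F` of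
characteristic `0` and `L/K` finite Galois with cyclic group** (Neukirch V (1.1), `i = 0`, via the
tree's `cyclicNormIndexEq_holds`): embed `L` into `F̄` over `F` (`IsAlgClosed.lift`), so that
`K ≃ K' ≤ L' ≃ L` inside `F̄` compatibly (`AlgHom.equivFieldRange`), transport Galois-ness and
cyclicity (`IsGalois.of_equiv_equiv`, `isCyclic_gal_of_equiv_equiv`), apply the axiom to
`K' ≤ L'`, and transport the norm index and the degree back
(`index_range_unitsMap_norm_eq_of_equiv_equiv`, `Algebra.finrank_eq_of_equiv_equiv`).
[cite: NeukirchANT1999, Ch. V §1, Thm. (1.1)] -/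
theorem normIndex_eq_finrank_of_isNonarchimedeanLocalField [CharZero F]
    (K L : Type u) [Field K] [Field L] [Algebra F K] [Algebra K L]
    [FiniteDimensional F K] [FiniteDimensional K L] [IsGalois K L] [IsCyclic (L ≃ₐ[K] L)] :
    (Units.map (Algebra.norm K (S := L) : L →* K)).range.index = Module.finrank K L := by
  letI : Algebra F L := ((algebraMap K L).comp (algebraMap F K)).toAlgebra
  haveI : IsScalarTower F K L := IsScalarTower.of_algebraMap_eq fun _ => rfl
  haveI : FiniteDimensional F L := FiniteDimensional.trans F K L
  -- the embeddings into `F̄`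
  let ψ : L →ₐ[F] AlgebraicClosure F := IsAlgClosed.lift
  let φ : K →ₐ[F] AlgebraicClosure F := ψ.comp (IsScalarTower.toAlgHom F K L)
  let K' : IntermediateField F (AlgebraicClosure F) := φ.fieldRange
  let L' : IntermediateField F (AlgebraicClosure F) := ψ.fieldRange
  have hKL : K' ≤ L' := by
    rintro _ ⟨y, rfl⟩
    exact ⟨algebraMap K L y, rfl⟩
  letI := towerAlgebra hKL
  let eK : K ≃ₐ[F] K' := φ.equivFieldRange
  let eL : L ≃ₐ[F] L' := ψ.equivFieldRange
  have he : (algebraMap K' L').comp ((eK : K ≃+* K') : K →+* K') =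
      ((eL : L ≃+* L') : L →+* L').comp (algebraMap K L) := by
    refine RingHom.ext fun y => Subtype.ext ?_
    rfl
  -- transport of the hypotheses
  haveI : IsGalois K' L' := IsGalois.of_equiv_equiv (f := (eK : K ≃+* K')) (g := (eL : L ≃+* L')) he
  haveI : IsCyclic (L' ≃ₐ[K'] L') := isCyclic_gal_of_equiv_equiv (eK : K ≃+* K') (eL : L ≃+* L') he
  haveI : FiniteDimensional F L' := eL.toLinearEquiv.finiteDimensional
  have hLs : L' ≤ sepClosure F := fun x _ =>
    mem_separableClosure_iff.2 (Algebra.IsSeparable.isSeparable F x)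
  -- the axiom for `K' ≤ L'`, transported back
  have h := cyclicNormIndexEq_holds F K' L' hKL hLs
  rw [index_range_unitsMap_norm_eq_of_equiv_equiv (eK : K ≃+* K') (eL : L ≃+* L') he, h]
  exact (Algebra.finrank_eq_of_equiv_equiv (eK : K ≃+* K') (eL : L ≃+* L') he).symm

end Local

end Literature.NumberTheory.GaloisRepresentations

end
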